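import Summits.RiemannHypothesis.RiemannHypothesis.Theorems.GroundBartaGroundBartaFloorDefs
import Summits.RiemannHypothesis.RiemannHypothesis.Theorems.OddSectorOddBartaFloorPhiDerivSmooth
import Mathlib.Analysis.SpecialFunctions.SmoothTransition
import Mathlib.Analysis.Calculus.MeanValue
import HarnessLib

/-!
# Smooth even approximants of the theta probe `K_a` (crux GroundBartaFloor, line
`phi_window_supersolution`, part of stub eulerLagrange)

The BV probe `K_a = groundThetaVector a = 𝟙_{[−a,a]}·Φ` jumps at `±a`, while the weak Euler–Lagrange
identity is only available for smooth window tests. From the smoothness of `Φ = weilThetaPhi`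
(`contDiff_weilThetaPhi`, via `OddBartaFloor.stub_phiDerivSmooth`) we construct smooth cut-off
approximants `h_m = θ_m · K_a`, where `θ_m(t) = q_m(t) q_m(−t)` is an even smooth plateau built from
Mathlib's `Real.smoothTransition`, `q_m(t) = smoothTransition ((m+1)(a+t) − 1)`:

* `h_m` is a Weil test function supported in `[−a, a]`, dominated by `|K_a|`;
* `h_m(t) → K_a(t)` for `|t| < a` (eventually `θ_m(t) = 1`);
* the increments are uniformly Lipschitz: `∫ |h_m(x+s) − h_m(x)|² dx ≤ K s` for `s ≥ 0` with `K`
  independent of `m`. Pointwise, `|h_m(x+s) − h_m(x)|² ≤ 4LMs·𝟙_{[−a,a]}(x) + 2M²Δ_m(x)` where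
  `M = sup_{[−a,a]} |Φ|`, `L = sup_{[−a,a]} |Φ′|` (mean value theorem) and `Δ_m(x)` is the sum of the
  increments of the two monotone plateau factors, each of which integrates to exactly `s`
  (shift identity `∫ (q(x+s) − q(x)) dx = s` for a continuous plateau rising from `0` to `1`).

This is the even twin of `OddSectorOddBartaFloorThetaApproximants.lean` (same plateau, `Φ` for `−Φ′`).
Elementary real analysis; no published source needed. [folklore]
-/

set_option linter.dupNamespace false

noncomputable section

open Set MeasureTheory Filter Complex
open scoped Real Topology ComplexConjugate ArithmeticFunction.vonMangoldt ENNReal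

namespace Summit.RiemannHypothesis.RiemannHypothesis.Theorems.GroundBartaFloor

open Literature.NumberTheory.LFunctions

/-- Shift identity for a continuous plateau `q` (`q = 0` on `(-∞, A]`, `q = 1` on `[B, ∞)`): for
`s ≥ 0` the increment `x ↦ q (x + s) - q x` is integrable with integral exactly `s`. [folklore] -/
private theorem groundApproximants_shift {q : ℝ → ℝ} (hq : Continuous q) {A B s : ℝ}
    (hA : ∀ x, x ≤ A → q x = 0) (hB : ∀ x, B ≤ x → q x = 1) (hs : 0 ≤ s) :
    Integrable (fun x => q (x + s) - q x) ∧ ∫ x, (q (x + s) - q x) = s := by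
  have hAB : A ≤ B :=
    le_of_lt (lt_of_not_ge fun h => one_ne_zero ((hB A h).symm.trans (hA A le_rfl)))
  have hsupp : Function.support (fun x => q (x + s) - q x) ⊆ Ioc (A - s) B := fun x hx => by
    rw [Function.mem_support] at hx
    refine ⟨lt_of_not_ge fun h => hx ?_, le_of_not_gt fun h => hx ?_⟩
    · rw [hA x (by linarith), hA (x + s) (by linarith), sub_zero]
    · rw [hB x h.le, hB (x + s) (by linarith), sub_self]
  have hqs : Continuous fun x => q (x + s) := by fun_prop
  have hc : Continuous fun x => q (x + s) - q x := hqs.sub hq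
  refine ⟨hc.integrable_of_hasCompactSupport (HasCompactSupport.intro isCompact_Icc fun x hx =>
    Function.notMem_support.1 fun h => hx (Ioc_subset_Icc_self (hsupp h))), ?_⟩
  have hi : ∀ u v, IntervalIntegrable q volume u v := fun u v => hq.intervalIntegrable u v
  rw [← intervalIntegral.integral_eq_integral_of_support_subset hsupp,
    intervalIntegral.integral_sub (hqs.intervalIntegrable _ _) (hi _ _),
    intervalIntegral.integral_comp_add_right, sub_add_cancel,
    ← intervalIntegral.integral_add_adjacent_intervals (hi A B) (hi B (B + s)),
    ← intervalIntegral.integral_add_adjacent_intervals (hi (A - s) A) (hi A B)]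
  have h1 : ∫ x in B..B + s, q x = s := by
    rw [intervalIntegral.integral_congr (g := fun _ => (1 : ℝ)) fun x hx => hB x ?_,
      intervalIntegral.integral_const, smul_eq_mul, mul_one, add_sub_cancel_left]
    rw [uIcc_of_le (by linarith)] at hx
    exact hx.1
  have h0 : ∫ x in A - s..A, q x = 0 := by
    rw [intervalIntegral.integral_congr (g := fun _ => (0 : ℝ)) fun x hx => hA x ?_,
      intervalIntegral.integral_const, smul_zero]
    rw [uIcc_of_le (by linarith)] at hx
    exact hx.2
  rw [h1, h0]
  ring

/-- Plateau algebra: for `0 ≤ a₀ ≤ a₁ ≤ 1` and `0 ≤ b₁ ≤ b₀ ≤ 1`,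
`|a₁ b₁ − a₀ b₀| ≤ (a₁ − a₀) + ((1 − b₁) − (1 − b₀))`. [folklore] -/
private theorem groundApproximants_plateau {a₀ a₁ b₀ b₁ : ℝ} (ha₀ : 0 ≤ a₀) (ha : a₀ ≤ a₁)
    (ha₁ : a₁ ≤ 1) (hb₁ : 0 ≤ b₁) (hb : b₁ ≤ b₀) (hb₀ : b₀ ≤ 1) :
    |a₁ * b₁ - a₀ * b₀| ≤ (a₁ - a₀) + ((1 - b₁) - (1 - b₀)) := by
  have h1 := mul_nonneg (sub_nonneg.2 ha) (sub_nonneg.2 (hb.trans hb₀))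
  have h2 := mul_nonneg ha₀ (sub_nonneg.2 hb)
  have h3 := mul_nonneg (sub_nonneg.2 ha) hb₁
  have h4 := mul_nonneg (sub_nonneg.2 (ha.trans ha₁)) (sub_nonneg.2 hb)
  rw [abs_le]
  constructor <;> nlinarith [h1, h2, h3, h4]

/-- Pointwise algebra of the increment bound. For plateau values `A, B ∈ [0, 1]` with
`|A - B| ≤ Δ`, amplitudes `|u|, |v| ≤ M`, and `|u - v| ≤ L s` whenever both plateau values are
positive: `(A u - B v)² ≤ 4 L M s · B + 2 M² Δ`. [folklore] -/
private theorem groundApproximants_alg {A B u v M L s Δ : ℝ} (hM : 0 ≤ M) (hLs : 0 ≤ L * s)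
    (hA0 : 0 ≤ A) (hA1 : A ≤ 1) (hB0 : 0 ≤ B) (hB1 : B ≤ 1) (hAB : |A - B| ≤ Δ)
    (hu : |u| ≤ M) (hv : |v| ≤ M) (huv : 0 < A → 0 < B → |u - v| ≤ L * s) :
    (A * u - B * v) ^ 2 ≤ 4 * L * M * s * B + 2 * M ^ 2 * Δ := by
  have hΔ0 : 0 ≤ Δ := (abs_nonneg _).trans hAB
  have hΔ1 : |A - B| ≤ 1 := abs_sub_le_iff.2 ⟨by linarith, by linarith⟩
  have hu2 : u ^ 2 ≤ M ^ 2 := by simpa only [sq_abs] using pow_le_pow_left₀ (abs_nonneg u) hu 2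
  have hv2 : v ^ 2 ≤ M ^ 2 := by simpa only [sq_abs] using pow_le_pow_left₀ (abs_nonneg v) hv 2
  -- the jump part `(A - B) u`
  have hr : ((A - B) * u) ^ 2 ≤ Δ * M ^ 2 := by
    rw [mul_pow, ← sq_abs (A - B)]
    exact mul_le_mul ((pow_le_of_le_one (abs_nonneg _) hΔ1 two_ne_zero).trans hAB) hu2
      (sq_nonneg _) hΔ0
  rcases hA0.eq_or_lt with rfl | hA
  · -- only the jump of `B` remains
    have hBΔ : B ≤ Δ := by rwa [zero_sub, abs_neg, abs_of_nonneg hB0] at hAB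
    have h1 : B * v ^ 2 ≤ Δ * M ^ 2 := mul_le_mul hBΔ hv2 (sq_nonneg _) hΔ0
    have h2 : B * (B * v ^ 2) ≤ B * v ^ 2 := mul_le_of_le_one_left (by positivity) hB1
    nlinarith [mul_nonneg (mul_nonneg hLs hM) hB0, sq_nonneg (B * v)]
  rcases hB0.eq_or_lt with rfl | hB
  · nlinarith [hr, sq_nonneg (A * u)]
  -- main case: `A u - B v = (A - B) u + B (u - v)`
  have hp : (B * (u - v)) ^ 2 ≤ B * (2 * M * (L * s)) := by
    have h1 : |u - v| ≤ 2 * M := (abs_sub _ _).trans (by linarith)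
    have h2 : (u - v) ^ 2 ≤ 2 * M * (L * s) := by
      rw [← sq_abs, sq]
      exact mul_le_mul h1 (huv hA hB) (abs_nonneg _) (by linarith)
    rw [mul_pow]
    exact mul_le_mul (pow_le_of_le_one hB0 hB1 two_ne_zero) h2 (sq_nonneg _) hB0
  nlinarith [hp, hr, sq_nonneg (B * (u - v) - (A - B) * u)]

/-- **`Φ = weilThetaPhi` is `C^∞`** (its derivative `Φ′ = weilThetaPhiDeriv` is,
`OddBartaFloor.stub_phiDerivSmooth`). [folklore] -/
theorem contDiff_weilThetaPhi : ContDiff ℝ ((⊤ : ℕ∞) : WithTop ℕ∞) weilThetaPhi := by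
  rw [contDiff_infty_iff_deriv, deriv_weilThetaPhi]
  exact ⟨differentiable_weilThetaPhi, OddBartaFloor.stub_phiDerivSmooth⟩

/-- **Smooth cut-off approximants of the BV probe `K_a`** with uniformly Lipschitz increments:
`h_m = θ_m · K_a` with the even smooth plateau `θ_m(t) = q_m(t) q_m(−t)`,
`q_m(t) = smoothTransition ((m+1)(a+t) − 1)`. [folklore] -/
theorem groundThetaApproximants :
    ∀ a : ℝ, 0 < a → ∃ K : ℝ, ∃ h : ℕ → ℝ → ℂ,
      (∀ m, IsWeilTest (h m) ∧ tsupport (h m) ⊆ Icc (-a) a) ∧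
      (∀ m s, 0 ≤ s → weilIncrement (h m) s ≤ K * s) ∧
      (∀ m t, ‖h m t‖ ≤ |groundThetaVector a t|) ∧
      (∀ t, t ∈ Ioo (-a) a → Tendsto (fun m => h m t) atTop (𝓝 ((groundThetaVector a t : ℝ) : ℂ))) := by
  intro a ha
  have hsmooth := contDiff_weilThetaPhi
  -- sup bounds for `Φ` and `Φ′` on the window, and the Lipschitz estimate
  obtain ⟨M, hM⟩ := (isCompact_Icc (a := -a) (b := a)).exists_bound_of_continuousOn
    continuous_weilThetaPhi.continuousOn
  obtain ⟨L, hL⟩ := (isCompact_Icc (a := -a) (b := a)).exists_bound_of_continuousOn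
    (hsmooth.continuous_deriv (by simp)).continuousOn
  have hM0 : 0 ≤ M := (norm_nonneg _).trans (hM 0 ⟨by linarith, ha.le⟩)
  have hL0 : 0 ≤ L := (norm_nonneg _).trans (hL 0 ⟨by linarith, ha.le⟩)
  have hlip : ∀ x ∈ Icc (-a) a, ∀ y ∈ Icc (-a) a,
      |weilThetaPhi y - weilThetaPhi x| ≤ L * |y - x| := fun x hx y hy => by
    simpa only [Real.norm_eq_abs] using (convex_Icc (-a) a).norm_image_sub_le_of_norm_deriv_le
      (fun z _ => hsmooth.differentiable (by simp) z) hL hx hy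
  have hHM : ∀ t, |groundThetaVector a t| ≤ M := fun t => by
    by_cases ht : t ∈ Icc (-a) a
    · rw [groundThetaVector_of_mem ht, ← Real.norm_eq_abs]
      exact hM t ht
    · rw [groundThetaVector_of_not_mem ht, abs_zero]
      exact hM0
  -- the monotone plateau factor `q m`
  obtain ⟨q, hq⟩ : ∃ q : ℕ → ℝ → ℝ,
      ∀ m x, q m x = Real.smoothTransition (((m : ℝ) + 1) * (a + x) - 1) := ⟨_, fun _ _ => rfl⟩
  have hqc : ∀ m, ContDiff ℝ ((⊤ : ℕ∞) : WithTop ℕ∞) (q m) := fun m => by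
    rw [show q m = fun x => Real.smoothTransition (((m : ℝ) + 1) * (a + x) - 1) from funext (hq m)]
    exact Real.smoothTransition.contDiff.comp (by fun_prop)
  have hq0 : ∀ m x, 0 ≤ q m x := fun m x => (hq m x).symm ▸ Real.smoothTransition.nonneg _
  have hq1 : ∀ m x, q m x ≤ 1 := fun m x => (hq m x).symm ▸ Real.smoothTransition.le_one _
  have hqm : ∀ m, Monotone (q m) := fun m x y hxy => by
    rw [hq, hq]
    have := mul_le_mul_of_nonneg_left (add_le_add_left hxy a) (by positivity : (0 : ℝ) ≤ (m : ℝ) + 1)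
    exact Real.smoothTransition.monotone (by linarith)
  have hqA : ∀ m x, x ≤ -a → q m x = 0 := fun m x hx => by
    rw [hq]
    exact Real.smoothTransition.zero_of_nonpos (by
      nlinarith [mul_nonneg (by positivity : (0 : ℝ) ≤ (m : ℝ) + 1) (by linarith : (0 : ℝ) ≤ -(a + x))])
  have hqone : ∀ (m : ℕ) (x : ℝ), 2 ≤ ((m : ℝ) + 1) * (a + x) → q m x = 1 := fun m x hx => by
    rw [hq]
    exact Real.smoothTransition.one_of_one_le (by linarith)
  have hqB : ∀ m x, -a + 2 ≤ x → q m x = 1 := fun m x hx =>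
    hqone m x (by nlinarith [mul_nonneg (by positivity : (0 : ℝ) ≤ (m : ℝ)) (by linarith : (0 : ℝ) ≤ a + x)])
  -- the even plateau `θ m t = q m t * q m (-t)` and the approximants `h m = θ m • H_a`
  obtain ⟨θ, hθ⟩ : ∃ θ : ℕ → ℝ → ℝ, ∀ m t, θ m t = q m t * q m (-t) := ⟨_, fun _ _ => rfl⟩
  have hθ0 : ∀ m t, 0 ≤ θ m t := fun m t => (hθ m t).symm ▸ mul_nonneg (hq0 m t) (hq0 m (-t))
  have hθ1 : ∀ m t, θ m t ≤ 1 := fun m t =>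
    (hθ m t).symm ▸ mul_le_one₀ (hq1 m t) (hq0 m (-t)) (hq1 m (-t))
  have hθe : ∀ m t, θ m (-t) = θ m t := fun m t => by rw [hθ, hθ, neg_neg, mul_comm]
  have hθz : ∀ m t, t ∉ Icc (-a) a → θ m t = 0 := fun m t ht => by
    rw [hθ]
    rcases not_and_or.1 (mt mem_Icc.2 ht) with h | h
    · exact mul_eq_zero_of_left (hqA m t (by linarith [not_le.1 h])) _
    · exact mul_eq_zero_of_right _ (hqA m (-t) (by linarith [not_le.1 h]))
  have hθW : ∀ m t, 0 < θ m t → t ∈ Icc (-a) a := fun m t h0 =>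
    by_contra fun ht => h0.ne' (hθz m t ht)
  obtain ⟨h, hh⟩ : ∃ h : ℕ → ℝ → ℂ, ∀ m t, h m t = ((θ m t * groundThetaVector a t : ℝ) : ℂ) :=
    ⟨_, fun _ _ => rfl⟩
  refine ⟨8 * a * L * M + 4 * M ^ 2, h, fun m => ⟨⟨?_, ?_⟩, ?_⟩, fun m s hs => ?_,
    fun m t => ?_, fun t ht => ?_⟩
  · -- smoothness: on and off the window `h m = θ m • Φ`
    have heq : h m = fun t => ((q m t * q m (-t) * weilThetaPhi t : ℝ) : ℂ) := by
      funext t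
      rw [hh, hθ]
      by_cases ht : t ∈ Icc (-a) a
      · rw [groundThetaVector_of_mem ht]
      · have h0 := hθz m t ht
        rw [hθ] at h0
        rw [h0, zero_mul, zero_mul]
    have hreal : ContDiff ℝ ((⊤ : ℕ∞) : WithTop ℕ∞) fun t => q m t * q m (-t) * weilThetaPhi t :=
      ((hqc m).mul ((hqc m).comp contDiff_neg)).mul hsmooth
    rw [heq]
    exact Complex.ofRealCLM.contDiff.comp hreal
  · exact HasCompactSupport.intro isCompact_Icc fun t ht => by
      rw [hh, hθz m t ht, zero_mul, Complex.ofReal_zero]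
  · exact closure_minimal (fun t ht => by_contra fun h' => ht (by
      rw [hh, hθz m t h', zero_mul, Complex.ofReal_zero])) isClosed_Icc
  · -- increments: `∫ |h(x+s) - h(x)|² ≤ ∫ (4LMs·𝟙_{[-a,a]} + 2M²·(Δq + Δr)) = (8aLM + 4M²) s`
    obtain ⟨r, hr⟩ : ∃ r : ℝ → ℝ, ∀ x, r x = 1 - q m (-x) := ⟨_, fun _ => rfl⟩
    have hrc : Continuous r := by
      rw [show r = fun x => 1 - q m (-x) from funext hr]
      have := (hqc m).continuous
      fun_prop
    obtain ⟨hi1, he1⟩ := groundApproximants_shift (hqc m).continuous (hqA m) (hqB m) hs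
    obtain ⟨hi2, he2⟩ := groundApproximants_shift hrc (A := a - 2) (B := a)
      (fun x hx => by rw [hr, hqB m (-x) (by linarith), sub_self])
      (fun x hx => by rw [hr, hqA m (-x) (by linarith), sub_zero]) hs
    have hind : Integrable ((Icc (-a) a).indicator fun _ => (4 * L * M * s : ℝ)) :=
      (integrableOn_const measure_Icc_lt_top.ne).integrable_indicator measurableSet_Icc
    have hrest : Integrable fun x => 2 * M ^ 2 * ((q m (x + s) - q m x) + (r (x + s) - r x)) :=
      (hi1.add hi2).const_mul (2 * M ^ 2)
    have hpt : ∀ x, ‖h m (x + s) - h m x‖ ^ 2 ≤ (Icc (-a) a).indicator (fun _ => 4 * L * M * s) x +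
        2 * M ^ 2 * ((q m (x + s) - q m x) + (r (x + s) - r x)) := fun x => by
      have hΔ : |θ m (x + s) - θ m x| ≤ (q m (x + s) - q m x) + (r (x + s) - r x) := by
        rw [hr, hr, hθ, hθ]
        exact groundApproximants_plateau (hq0 m x) (hqm m (le_add_of_nonneg_right hs))
          (hq1 m _) (hq0 m _) (hqm m (neg_le_neg (le_add_of_nonneg_right hs))) (hq1 m _)
      rw [hh, hh, ← Complex.ofReal_sub, Complex.norm_real, Real.norm_eq_abs, sq_abs]
      refine (groundApproximants_alg hM0 (mul_nonneg hL0 hs) (hθ0 m _) (hθ1 m _) (hθ0 m _)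
        (hθ1 m _) hΔ (hHM _) (hHM _) fun hA hB => ?_).trans (add_le_add ?_ le_rfl)
      · have hxs := hθW m _ hA
        have hx := hθW m _ hB
        rw [groundThetaVector_of_mem hxs, groundThetaVector_of_mem hx]
        have := hlip x hx (x + s) hxs
        rwa [add_sub_cancel_left, abs_of_nonneg hs] at this
      · by_cases hx : x ∈ Icc (-a) a
        · rw [indicator_of_mem hx]
          exact mul_le_of_le_one_right (by positivity) (hθ1 m x)
        · rw [indicator_of_notMem hx, hθz m x hx, mul_zero]
    have hD : Integrable fun x => (Icc (-a) a).indicator (fun _ => 4 * L * M * s) x +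
        2 * M ^ 2 * ((q m (x + s) - q m x) + (r (x + s) - r x)) := hind.add hrest
    unfold weilIncrement
    refine (integral_mono_of_nonneg (Eventually.of_forall fun x => by positivity) hD
      (Eventually.of_forall hpt)).trans_eq ?_
    rw [integral_add hind hrest, integral_const_mul, integral_add hi1 hi2, he1, he2,
      integral_indicator_const _ measurableSet_Icc, Real.volume_real_Icc_of_le (by linarith),
      smul_eq_mul]
    ring
  · -- domination by `|K_a|`
    rw [hh, Complex.norm_real, Real.norm_eq_abs, abs_mul, abs_of_nonneg (hθ0 m t)]
    exact mul_le_of_le_one_left (abs_nonneg _) (hθ1 m t)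
  · -- convergence inside the window: eventually `θ m t = 1`
    have hd : 0 < a - |t| := by
      rw [sub_pos, abs_lt]
      exact ⟨ht.1, ht.2⟩
    obtain ⟨N, hN⟩ := exists_nat_ge (2 / (a - |t|))
    have hN' : 2 ≤ (N : ℝ) * (a - |t|) := (div_le_iff₀ hd).1 hN
    refine tendsto_const_nhds.congr' ((eventually_ge_atTop N).mono fun m hm => ?_)
    have hm' : (N : ℝ) * (a - |t|) ≤ ((m : ℝ) + 1) * (a - |t|) :=
      mul_le_mul_of_nonneg_right (by exact_mod_cast Nat.le_succ_of_le hm) hd.le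
    have e1 : q m t = 1 := hqone m t (by
      nlinarith [mul_le_mul_of_nonneg_left (show a - |t| ≤ a + t by linarith [neg_abs_le t])
        (by positivity : (0 : ℝ) ≤ (m : ℝ) + 1)])
    have e2 : q m (-t) = 1 := hqone m (-t) (by
      nlinarith [mul_le_mul_of_nonneg_left (show a - |t| ≤ a + -t by linarith [le_abs_self t])
        (by positivity : (0 : ℝ) ≤ (m : ℝ) + 1)])
    show ((groundThetaVector a t : ℝ) : ℂ) = h m t
    rw [hh, hθ, e1, e2, one_mul, one_mul]

end Summit.RiemannHypothesis.RiemannHypothesis.Theorems.GroundBartaFloor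

end
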